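import Summits.HodgeConjecture.HodgeConjecture.Theorems.WeilTypeLadderFloorFromLocalAnchor
import Literature.AlgebraicGeometry.HodgeTheory.HyperbolicWeilTypeExistence
import HarnessLib

/-!
# WeilTypeLadder · ON-PATH lemma of the local anchors: `HodgeConjecture → HasLocallyAlgebraicWeilAnchor n d` (all `n ≥ 2`, `d ≥ 1`),
# hence `HodgeConjecture → Markman2025_secantAnchor_locallyAlgebraic_sixfold`; anti-vacuity of the split rungs

b2b cell `hweil` (packet `run/shared/lean/b2b/hodge-weil/`). Prover 2, generation 3. The forward contract of the ladder
("every rung / fact `R` lands with `R_of_HodgeConjecture`") for the local-anchor layer of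
`Theorems/WeilTypeLadderLocalAnchor.lean`: there, `hasLocallyAlgebraicWeilAnchor_of_hodgeConjecture` reduced
`HC → HasLocallyAlgebraicWeilAnchor n d` to the EXISTENCE of a hyperbolic anchor `(P, ψ₀, e, a)` with a non-zero
rational Weil class; `Literature/…/HyperbolicWeilTypeExistence.lean` (this seat, proofs only) supplies it for every
`n ≥ 2`, `d ≥ 1` (induction from the Weil surface `E × E` by partner surfaces — the tree's proved
`exists_weilTypeSurface_prod_isHyperbolicWeilType_all_holds` — with hyperbolic ⟹ balanced ⟹ a non-zero rational
`(n,n)` Weil class). Hence: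

* `hasLocallyAlgebraicWeilAnchor_of_hodgeConjecture_all : HodgeConjecture → ∀ n ≥ 2, ∀ d ≥ 1, HasLocallyAlgebraicWeilAnchor n d`;
* `markman2025_secantAnchor_locallyAlgebraic_sixfold_of_hodgeConjecture : HodgeConjecture →
  Markman2025_secantAnchor_locallyAlgebraic_sixfold` — the ON-PATH lemma of the claim-fact (it is a CASE of the
  summit: nothing beyond HC is asserted by it);
* ANTI-VACUITY (referee request C6, now kernel-checked): `exists_floorSixfold_instance` / `exists_floorFourfold_instance`
  — the hypothesis bundles of the floor facts F0a (`Markman2025_weilClasses_algebraic_hyperbolicSixfold`: a hyperbolic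
  sixfold `(A, φ, e, a)` with a NON-ZERO rational `(3,3)` Weil class) and F1 / R∞ at `n = 2` (a Weil-type FOURFOLD with
  a non-zero rational `(2,2)` Weil class) are INHABITED for every `d ≥ 1`, and likewise `SplitEightfolds` (`n = 4`) and
  `SplitWeilAbelianVarieties` (every `n ≥ 4`): none of the ladder's split statements is vacuous.
* `weilClassesImaginaryQuadratic_of_reach_of_localAnchors` — the TOP of the quadratic ladder from local anchors:
  `weilFamilyReach_hyperbolic` ∧ (`∀ d ≥ 1`, LOCAL(3, 4d)) ∧ (`∀ n ≥ 4, ∀ d ≥ 1`, LOCAL(n, d)) ⟹ R∞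
  (`WeilClassesImaginaryQuadratic`: Weil's 1977 question for every imaginary quadratic field, every dimension `2n ≥ 4`
  and EVERY discriminant) — by `weilClassesImaginaryQuadratic_iff_floor_and_split` (R∞ ⟺ F0a ∧ R2, degeneration one
  dimension up) with F0a and R2 from local anchors. So, above Deligne's reach, Weil's question IS the existence of one
  locally algebraic hyperbolic anchor per `(n, d)`, `n ≥ 3`.

No definition; sorry-free. Serves stmt-HodgeConjecture-2524 without closing it.
-/

-- every declaration of this problem lives in `Summit.HodgeConjecture.HodgeConjecture.…` (summit = sub-problem)
set_option linter.dupNamespace false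

noncomputable section

open CategoryTheory AlgebraicGeometry

namespace Summit.HodgeConjecture.HodgeConjecture.WeilTypeLadder

open Literature.AlgebraicGeometry Literature.AlgebraicGeometry.Motives
open Literature.AlgebraicGeometry.HodgeTheory
open Literature.AlgebraicTopology.SingularHomology

/-- **ON-PATH: `HodgeConjecture → HasLocallyAlgebraicWeilAnchor n d` for every `n ≥ 2`, `d ≥ 1`.** The anchor
data exist unconditionally (`exists_isHyperbolicWeilType_with_weilClass`); the local clause is automatic under HC
(`hasLocallyAlgebraicWeilAnchor_of_hodgeConjecture`). [folklore] -/
theorem hasLocallyAlgebraicWeilAnchor_of_hodgeConjecture_all (hHC : _root_.HodgeConjecture) (n d : ℕ)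
    (hn : 2 ≤ n) (hd : 0 < d) : HasLocallyAlgebraicWeilAnchor n d := by
  obtain ⟨P, ψ₀, e, a, w, hP, hψ₀, ha, ha0, hhyp, hwW, hwr, hw0, -⟩ :=
    exists_isHyperbolicWeilType_with_weilClass n d hn hd
  exact hasLocallyAlgebraicWeilAnchor_of_hodgeConjecture hHC n d ⟨P, ψ₀, e, a, w, hP, hψ₀, ha, ha0, hhyp, hwW, hwr, hw0⟩

/-- **ON-PATH lemma of the claim-fact: `HodgeConjecture → Markman2025_secantAnchor_locallyAlgebraic_sixfold`.** The
local statement at the secant anchor is a CASE of the summit (nothing beyond HC is asserted by the fact).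
[cite: Markman2025SecantWeil, §1.5 and Thm. 1.5.1] -/
theorem markman2025_secantAnchor_locallyAlgebraic_sixfold_of_hodgeConjecture (hHC : _root_.HodgeConjecture) :
    Markman2025_secantAnchor_locallyAlgebraic_sixfold :=
  fun d hd => hasLocallyAlgebraicWeilAnchor_of_hodgeConjecture_all hHC 3 d (by norm_num) hd

/-! ### Anti-vacuity of the floor and of the split rungs (referee C6) -/

/-- **F0a is not vacuous**: for every `d ≥ 1` there are a complex abelian SIXFOLD `(A, φ)`, `φ ≫ φ = -d`, smooth
projective, a projective embedding `e` and a rational `a ≠ 0` with `(A, φ)` HYPERBOLIC for `d·e^*a + φ^*e^*a`, and a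
NON-ZERO rational `(3,3)` class in `weilClassesOf A φ 3 d` — i.e. every hypothesis of
`Markman2025_weilClasses_algebraic_hyperbolicSixfold` is met with a non-zero class.
[cite: vanGeemen1994HodgeAV, 4.9, Lemma 5.2 and 5.5] -/
theorem exists_floorSixfold_instance (d : ℕ) (hd : 0 < d) :
    ∃ (A : AbelianVariety ℂ) (φ : A ⟶ A) (e : ProjectiveEmbedding A.X)
      (a : complexBetti (projectiveSpace e.n ℂ) 2) (c : complexBetti A.X (2 * 3)),
      A.dim = 2 * 3 ∧ IsSmoothProjective (2 * 3) A.X ∧ φ ≫ φ = -(d • 𝟙 A) ∧ IsRationalClass a ∧ a ≠ 0 ∧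
      IsHyperbolicWeilType A φ 3
        ((d : ℂ) • complexBetti.map e.ι 2 a + complexBetti.map φ.hom.hom.hom 2 (complexBetti.map e.ι 2 a)) ∧
      IsRationalClass c ∧ IsOfHodgeType (2 * 3) A.X (2 * 3) 3 3 c ∧ c ∈ weilClassesOf A φ 3 d ∧ c ≠ 0 := by
  obtain ⟨P, ψ₀, e, a, w, hP, hψ₀, ha, ha0, hhyp, hwW, hwr, hw0, hwH⟩ :=
    exists_isHyperbolicWeilType_with_weilClass 3 d (by norm_num) hd
  exact ⟨P, ψ₀, e, a, w, hP, isSmoothProjective_of_dim_eq' hP, hψ₀, ha, ha0, hhyp, hwr, hwH, hwW, hw0⟩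

/-- **F1 / R∞ at `n = 2` are not vacuous (the referee's C6 witness)**: for every `d ≥ 1` a Weil-type abelian
FOURFOLD `(A, φ)`, `φ ≫ φ = -d`, with a NON-ZERO rational `(2,2)` class in its Weil plane (in fact a hyperbolic one,
`(E × E) × S`). [cite: vanGeemen1994HodgeAV, 4.9 and 5.5] -/
theorem exists_floorFourfold_instance (d : ℕ) (hd : 0 < d) :
    ∃ (A : AbelianVariety ℂ) (φ : A ⟶ A) (c : complexBetti A.X (2 * 2)),
      A.dim = 2 * 2 ∧ IsSmoothProjective (2 * 2) A.X ∧ φ ≫ φ = -(d • 𝟙 A) ∧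
      IsRationalClass c ∧ IsOfHodgeType (2 * 2) A.X (2 * 2) 2 2 c ∧ c ∈ weilClassesOf A φ 2 d ∧ c ≠ 0 := by
  obtain ⟨A, φ, c, hA, hφ, hcr, hcH, hcW, hc0⟩ := exists_weilType_rational_hodge_weilClass 2 d (by norm_num) hd
  exact ⟨A, φ, c, hA, isSmoothProjective_of_dim_eq' hA, hφ, hcr, hcH, hcW, hc0⟩

/-- **The split rungs are not vacuous**: for every `n ≥ 2` and `d ≥ 1` the hypothesis bundle of
`SplitWeilAbelianVarieties` / `SplitEightfolds` / F0a at `(n, d)` — a hyperbolic `(A, φ, e, a)` of dimension `2n` and a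
non-zero rational `(n,n)` Weil class — is inhabited. [cite: vanGeemen1994HodgeAV, 4.9, Lemma 5.2 and 5.5] -/
theorem exists_splitRung_instance (n d : ℕ) (hn : 2 ≤ n) (hd : 0 < d) :
    ∃ (A : AbelianVariety ℂ) (φ : A ⟶ A) (e : ProjectiveEmbedding A.X)
      (a : complexBetti (projectiveSpace e.n ℂ) 2) (c : complexBetti A.X (2 * n)),
      A.dim = 2 * n ∧ IsSmoothProjective (2 * n) A.X ∧ φ ≫ φ = -(d • 𝟙 A) ∧ IsRationalClass a ∧ a ≠ 0 ∧
      IsHyperbolicWeilType A φ n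
        ((d : ℂ) • complexBetti.map e.ι 2 a + complexBetti.map φ.hom.hom.hom 2 (complexBetti.map e.ι 2 a)) ∧
      IsRationalClass c ∧ IsOfHodgeType (2 * n) A.X (2 * n) n n c ∧ c ∈ weilClassesOf A φ n d ∧ c ≠ 0 := by
  obtain ⟨P, ψ₀, e, a, w, hP, hψ₀, ha, ha0, hhyp, hwW, hwr, hw0, hwH⟩ :=
    exists_isHyperbolicWeilType_with_weilClass n d hn hd
  exact ⟨P, ψ₀, e, a, w, hP, isSmoothProjective_of_dim_eq' hP, hψ₀, ha, ha0, hhyp, hwr, hwH, hwW, hw0⟩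

/-! ### The top of the quadratic ladder from local anchors -/

/-- **R∞ (Weil 1977, every imaginary quadratic `K`, every `n ≥ 2`, every discriminant) from Deligne's reach and one
locally algebraic hyperbolic anchor per `(n, d)`, `n ≥ 3`** (`n = 3` at `4d`, Markman's regime): F0a and R2 from the
anchors (`markman2025_hyperbolicSixfold_of_reach_of_localAnchor_four_mul`, `splitWeilAbelianVarieties_of_reach_of_localAnchor`),
then `R∞ ⟺ F0a ∧ R2` (`weilClassesImaginaryQuadratic_iff_floor_and_split`: degeneration to products with Weil surfaces,
Schoen's transfer). [cite: Deligne1982HodgeCycles, proof of Thm. 4.8] [cite: Schoen1998HodgeWeilAddendum, §10 (Proposition)]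
[cite: Markman2025SurveySecant, §11.5 Steps 1–2] -/
theorem weilClassesImaginaryQuadratic_of_reach_of_localAnchors (hF : weilFamilyReach_hyperbolic)
    (h3 : ∀ d : ℕ, 0 < d → HasLocallyAlgebraicWeilAnchor 3 (4 * d))
    (h4 : ∀ n : ℕ, 4 ≤ n → ∀ d : ℕ, 0 < d → HasLocallyAlgebraicWeilAnchor n d) :
    WeilClassesImaginaryQuadratic :=
  weilClassesImaginaryQuadratic_iff_floor_and_split.2
    ⟨markman2025_hyperbolicSixfold_of_reach_of_localAnchor_four_mul hF h3,
      splitWeilAbelianVarieties_of_reach_of_localAnchor hF h4⟩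

/-- **Conversely, under HC all these local anchors exist** (`hasLocallyAlgebraicWeilAnchor_of_hodgeConjecture_all`), so
the hypothesis bundle of `weilClassesImaginaryQuadratic_of_reach_of_localAnchors` is implied by the summit: the
reduction loses nothing. [folklore] -/
theorem localAnchors_of_hodgeConjecture (hHC : _root_.HodgeConjecture) :
    (∀ d : ℕ, 0 < d → HasLocallyAlgebraicWeilAnchor 3 (4 * d)) ∧
      (∀ n : ℕ, 4 ≤ n → ∀ d : ℕ, 0 < d → HasLocallyAlgebraicWeilAnchor n d) :=
  ⟨fun d hd => hasLocallyAlgebraicWeilAnchor_of_hodgeConjecture_all hHC 3 (4 * d) (by norm_num) (by omega),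
    fun n hn d hd => hasLocallyAlgebraicWeilAnchor_of_hodgeConjecture_all hHC n d (by omega) hd⟩

end Summit.HodgeConjecture.HodgeConjecture.WeilTypeLadder

end
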